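import Summits.NavierStokesRegularity.FluidComputer.PalasekTowerClayBridge

/-!
# The episode split of Palasek's Step 2: schedule + stages, and the PROVED assembly

Cell `ns-blowup`, seat `ns-blowup-ecbridge-1`; ROUTE-BRIEF-EC-BRIDGE.md v1.1 §2 (S1) / §5 (DIRECTOR-NS
RE-POINT 2026-08-25T18:17:51Z). LABEL: E-C typing; WHAT THIS IS NOT: not Navier–Stokes evidence, not
a construction — a typed SPLIT of the open conditional `PalasekStep2 R` into a finite-depth base K1
and an induction step K2, with the assembly (chain gluing) PROVED, so the two pieces are the only
open content. `Schedule R` = style (α) of the cell's dichotomy: blow-up time, strictly increasing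
readout times with the Palasek clock, constants, ball, Clay DATUM and Clay-class FORCE fixed in
advance, the junk-excluding `push_small` (|f| ≤ c₄ Y_k ≤ c₁ Y_k on growth windows; refuter PRE-REG
K-PROBE (P1)), the pins `gap` (strict amplification) and `c₅ ≤ 4bβ` (visibility windows), label loops
and scheduled circulations for circulation-type margins. `Margins R` = the REGISTERED margin
predicate (P2), a PARAMETER of the split (candidate `Margins.kelvinLedger` in the sibling file
`PalasekTowerKelvinLedger.lean`). `Stage ν R S m k` = exact classical forced solution on the closed
slab `[0, τ k]` with energy, the envelope and timing of levels `j ≤ k`, and the margin.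
`EpisodeBase` (K1) / `EpisodeInduction` (K2) = the two open pieces. `Realisation.ofEpisodes`,
`nonempty_realisation_of_episodes : K1 m → K2 m → Nonempty (Realisation ν R)` = THE ASSEMBLY,
proved (choice along `ℕ`, gluing of the increasing chain of slab solutions into one classical
solution on `[0, T)`: `ContDiffWithinAt.mono_of_mem_nhdsWithin`, `derivWithin_inter`,
`IsSmoothSpaceTimeOn.timeDerivWithin_eq_of_subset`); with `palasekStep2_of_realisation` and the
bridge this reaches Fefferman's (C) modulo W21′. The split is only as good as the registered `m`
(two-sided vacuity trap, P2) — planning content, not hidden here.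

References: S. Palasek, arXiv:2605.13827 §3.3 (trapping region, schedule) [cite: Palasek2026ElementaryModel, §3];
C. L. Fefferman, Clay problem description, (C) [cite: FeffermanClay2006, (C)]; J. T. Beale, T. Kato, A. Majda,
Comm. Math. Phys. 94 (1984) §1 (continuation) [cite: BealeKatoMajda1984, §1].
-/

noncomputable section

namespace Summit.NavierStokesRegularity.FluidComputer.PalasekTowerClayBridge

open Set MeasureTheory Filter Topology Function
open scoped ENNReal ContDiff NNReal
open Literature.Analysis.FluidPDE

/-! ## §1 Schedules (style (α): datum, force and readout times fixed in advance) -/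

/-- **A schedule for the rates `R`** (style (α)): blow-up time `T`, strictly increasing readout times
`τ k ∈ (0, T)` with the Palasek clock `T - τ (k+1) ≤ c₃ / A_k`, envelope constants and ball, the Clay
datum `u₀` (Fefferman (4)) and the Clay-class force `f` FIXED IN ADVANCE (smooth on the closed
half-space, decay (5), silent from `T` on), the junk-excluding bound `|f| ≤ c₄ Y_k`, `c₄ ≤ c₁`, on
each growth window `[τ k, τ (k+1)]` (refuter PRE-REG K-PROBE (P1): prescribed-velocity fakes need
`|f| ≍ Y_{k+1} A_k` there), and the two pins that give the envelope finite-depth content: strict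
amplification `c₂ Y₀ < c₁ Y₁` and visibility windows `≤ c₅ log N_{k+1}/A_k`, `c₅ ≤ 4bβ` (a force
`≤ c₁ Y_k` acting linearly for that long moves the velocity by `≲ c₁ log(N_{k+1})/N_k ≪ Y_{k+1}`:
reaching the next floor in the window is FAST, i.e. genuine, dynamics). [cite: Palasek2026ElementaryModel, §3.3] -/
structure Schedule (R : TowerRates) where
  /-- blow-up time -/
  T : ℝ
  /-- readout times -/
  τ : ℕ → ℝ
  τ_zero_pos : 0 < τ 0
  τ_lt_succ : ∀ k, τ k < τ (k + 1)
  τ_lt_T : ∀ k, τ k < T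
  /-- envelope constants and ball -/
  c₁ : ℝ
  c₂ : ℝ
  c₃ : ℝ
  c₄ : ℝ
  c₅ : ℝ
  c₁_pos : 0 < c₁
  /-- the window force is pinned to the CURRENT floor scale (no free constant: `c₄ ≤ c₁`) -/
  c₄_le : c₄ ≤ c₁
  /-- the visibility window of a level is at most `4 b β log N_{k+1} / A_k` (Palasek: growth at rate
  `≥ ¾ A_k` through a factor `≤ N_k^{bβ}`) — pinned, not free -/
  c₅_le : c₅ ≤ 4 * R.b * R.β
  /-- strict amplification: the first floor beats the datum's ceiling, `c₂ Y₀ < c₁ Y₁` (hence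
  `c₁ Y_{k+1} > c₂ Y_k` at every level, with ratio `→ ∞`) -/
  gap : c₂ * R.Y 0 < c₁ * R.Y 1
  radius : ℝ
  /-- Palasek clock -/
  clock : ∀ k, T - τ (k + 1) ≤ c₃ / R.A k
  /-- the datum, fixed in advance -/
  u₀ : EuclideanSpace ℝ (Fin 3) → EuclideanSpace ℝ (Fin 3)
  datum_decay : HasRapidSpatialDecay u₀
  /-- the force, fixed in advance, on all of `[0, ∞) × ℝ³` -/
  f : ℝ → EuclideanSpace ℝ (Fin 3) → EuclideanSpace ℝ (Fin 3)
  force_smooth : IsSmoothOnHalfSpace f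
  force_decay : HasRapidSpaceTimeDecay f
  force_silent : ∀ t, T ≤ t → ∀ x, f t x = 0
  /-- the force is at most host-floor-sized on each growth window (junk exclusion, P1) -/
  push_small : ∀ k, ∀ t ∈ Icc (τ k) (τ (k + 1)), ∀ x, ‖f t x‖ ≤ c₄ * R.Y k
  /-- LABEL LOOPS and scheduled dormant circulations (design data for circulation-type margins such
  as `Margins.kelvinLedger`; a schedule whose registered margin ignores them may take constant loops) -/
  loop : ℕ → ℝ → EuclideanSpace ℝ (Fin 3)
  loop_smooth : ∀ j, ContDiff ℝ 1 (loop j)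
  loop_closed : ∀ j, loop j 0 = loop j 1
  Φ : ℕ → ℝ
  Φ_pos : ∀ j, 0 < Φ j

namespace Schedule

variable {R : TowerRates} (S : Schedule R)

/-- The readout times are strictly increasing. [folklore] -/
theorem τ_strictMono : StrictMono S.τ := strictMono_nat_of_lt_succ S.τ_lt_succ

/-- The readout times are monotone. [folklore] -/
theorem τ_mono {i j : ℕ} (h : i ≤ j) : S.τ i ≤ S.τ j := S.τ_strictMono.monotone h

/-- The readout times are positive. [folklore] -/
theorem τ_pos (k : ℕ) : 0 < S.τ k := lt_of_lt_of_le S.τ_zero_pos (S.τ_mono (Nat.zero_le k))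

/-- The blow-up time is positive. [folklore] -/
theorem T_pos : 0 < S.T := lt_trans (S.τ_pos 0) (S.τ_lt_T 0)

/-- The clock forces the readout times to exhaust `[0, T)`: every `T' < T` is passed by some
`τ (n+1)`. [folklore] -/
theorem exists_lt_τ {T' : ℝ} (hT' : T' < S.T) : ∃ n, T' < S.τ (n + 1) := by
  have hA : Tendsto R.A atTop atTop := by
    have hβ : 0 < R.β := by linarith [R.two_lt_β]
    exact (tendsto_rpow_atTop hβ).comp R.tendsto_N_atTop
  have h0 : Tendsto (fun k => S.c₃ / R.A k) atTop (𝓝 0) := tendsto_const_nhds.div_atTop hA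
  have hev : ∀ᶠ k in atTop, S.c₃ / R.A k < S.T - T' :=
    (tendsto_order.1 h0).2 _ (by linarith)
  obtain ⟨n, hn⟩ := hev.exists
  exact ⟨n, by linarith [S.clock n]⟩

end Schedule

/-! ## §2 Margins and stages -/

/-- **A registered margin set** (P2): for a schedule `S` and a level index `k`, a predicate on the
velocity history of a stage at level `k` (what the induction is allowed to assume at `τ k` and must
re-establish at `τ (k+1)`). A PARAMETER of the split; the cell registers one before filing. [folklore] -/
def Margins (R : TowerRates) : Type :=
  Schedule R → ℕ → (ℝ → EuclideanSpace ℝ (Fin 3) → EuclideanSpace ℝ (Fin 3)) → Prop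

/-- **A stage at level `k` of the schedule `S` with margins `m` at viscosity `ν`.** An exact classical
solution `(u, p)` of the forced system with `S`'s force on the CLOSED slab `[0, τ k] × ℝ³` from `S`'s
datum, with finite energy there, realising the envelope of the levels `j ≤ k` (floors
`c₁ Y_j ≤ |u(τ j, x_j)|` in the ball, ceilings `|u| ≤ c₂ Y_j` on `[0, τ j]`, and the TIMING: level
`j+1` invisible until `c₅ log N_{j+1}/A_j` before `τ (j+1)` — so the amplification by the factor
`c₁ Y_{j+1} / (c₂ Y_j) > 1` happens inside a window in which the admissible force can move the
velocity only by `≲ c₁ log(N_{j+1}) / N_j`) and the registered margin. A TYPE; no instance is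
claimed. [cite: Palasek2026ElementaryModel, §3.3] -/
structure Stage (ν : ℝ) (R : TowerRates) (S : Schedule R) (m : Margins R) (k : ℕ) where
  /-- velocity and pressure on `[0, τ k]` -/
  u : ℝ → EuclideanSpace ℝ (Fin 3) → EuclideanSpace ℝ (Fin 3)
  p : ℝ → EuclideanSpace ℝ (Fin 3) → ℝ
  classical : IsClassicalNSSolutionOn (Icc 0 (S.τ k)) ν S.f u p
  initial : u 0 = S.u₀
  energy : ∃ C : ℝ≥0∞, C < ⊤ ∧ ∀ t ∈ Icc 0 (S.τ k), ∫⁻ x, ‖u t x‖ₑ ^ 2 ≤ C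
  floor : ∀ j, j ≤ k → ∃ x, ‖x‖ ≤ S.radius ∧ S.c₁ * R.Y j ≤ ‖u (S.τ j) x‖
  ceiling : ∀ j, j ≤ k → ∀ t ∈ Icc 0 (S.τ j), ∀ x, ‖u t x‖ ≤ S.c₂ * R.Y j
  /-- super-lacunary TIMING (two-sided clock): level `j+1` stays invisible (`|u| ≤ c₂ Y_j`
  everywhere) until `c₅ log N_{j+1} / A_j` before its readout `τ (j+1)` -/
  quiet : ∀ j, j + 1 ≤ k →
    ∀ t ∈ Icc 0 (S.τ (j + 1) - S.c₅ * Real.log (R.N (j + 1)) / R.A j), ∀ x, ‖u t x‖ ≤ S.c₂ * R.Y j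
  margin : m S k u

/-- A stage at level `k+1` EXTENDS a stage at level `k`: same velocity and pressure on `[0, τ k]`.
[folklore] -/
def Stage.Extends {ν : ℝ} {R : TowerRates} {S : Schedule R} {m : Margins R} {k : ℕ}
    (s : Stage ν R S m k) (s' : Stage ν R S m (k + 1)) : Prop :=
  ∀ t ∈ Icc 0 (S.τ k), s'.u t = s.u t ∧ s'.p t = s.p t

/-! ## §3 The two open pieces -/

/-- **K1 — EPISODE BASE (open; never asserted here).** Some schedule for the rates `R` admits a
stage at level `1`: the datum's host (level 0) and the first grown level, i.e. ONE episode of genuine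
forced-Navier–Stokes dynamics under `push_small`, with the registered margins `m`. Finite depth;
compatible with the Kelvin ceiling (`Literature.Barriers.NavierStokesRegularity.PalasekTowerKelvinCeiling`,
one episode). [cite: Palasek2026ElementaryModel, §4] -/
def EpisodeBase (ν : ℝ) (R : TowerRates) (m : Margins R) : Prop :=
  ∃ S : Schedule R, Nonempty (Stage ν R S m 1)

/-- **K2 — EPISODE INDUCTION (open; the hard piece; never asserted here).** For every schedule and
every level `k ≥ 1`, a stage at level `k` with margins `m` extends to a stage at level `k+1` with
margins `m` (the next level grows to its floor inside the clock while the force is host-small, and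
the margin is re-established). This is where X3″ / heredity / the Kelvin evasion and the
prescribed-velocity and exact-ansatz walls live. [cite: Palasek2026ElementaryModel, §4] -/
def EpisodeInduction (ν : ℝ) (R : TowerRates) (m : Margins R) : Prop :=
  ∀ (S : Schedule R) (k : ℕ), 1 ≤ k → ∀ s : Stage ν R S m k,
    ∃ s' : Stage ν R S m (k + 1), s.Extends s'

/-! ## §4 The assembly: a coherent chain of stages glues to a realisation -/

namespace Assembly

variable {ν : ℝ} {R : TowerRates} {S : Schedule R} {m : Margins R}

/-- The chain of stages produced by iterating K2 from a level-1 stage (choice along `ℕ`). [folklore] -/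
def chain (s₁ : Stage ν R S m 1)
    (step : ∀ n, ∀ s : Stage ν R S m (n + 1), ∃ s' : Stage ν R S m (n + 1 + 1), s.Extends s') :
    (n : ℕ) → Stage ν R S m (n + 1) :=
  fun n => Nat.rec (motive := fun n => Stage ν R S m (n + 1)) s₁
    (fun n s => Classical.choose (step n s)) n

/-- Consecutive links of the chain extend each other. [folklore] -/
theorem chain_extends (s₁ : Stage ν R S m 1)
    (step : ∀ n, ∀ s : Stage ν R S m (n + 1), ∃ s' : Stage ν R S m (n + 1 + 1), s.Extends s')
    (n : ℕ) : (chain s₁ step n).Extends (chain s₁ step (n + 1)) :=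
  Classical.choose_spec (step n (chain s₁ step n))

/-- Any later link agrees with an earlier one on the earlier slab. [folklore] -/
theorem chain_agree (s₁ : Stage ν R S m 1)
    (step : ∀ n, ∀ s : Stage ν R S m (n + 1), ∃ s' : Stage ν R S m (n + 1 + 1), s.Extends s')
    {i j : ℕ} (hij : i ≤ j) :
    ∀ t ∈ Icc 0 (S.τ (i + 1)), (chain s₁ step j).u t = (chain s₁ step i).u t ∧
      (chain s₁ step j).p t = (chain s₁ step i).p t := by
  induction j, hij using Nat.le_induction with
  | base => intro t _; exact ⟨rfl, rfl⟩
  | succ j hle ih =>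
    intro t ht
    have ht' : t ∈ Icc 0 (S.τ (j + 1)) :=
      ⟨ht.1, le_trans ht.2 (S.τ_mono (Nat.succ_le_succ hle))⟩
    obtain ⟨hu, hp⟩ := chain_extends s₁ step j t ht'
    obtain ⟨hu', hp'⟩ := ih t ht
    exact ⟨hu.trans hu', hp.trans hp'⟩

end Assembly

open Assembly in
/-- **THE ASSEMBLY.** From a level-1 stage and the induction step for its schedule, a realisation of
the tower at the same viscosity: iterate the step (choice along `ℕ`), glue the increasing chain of
slab solutions into one classical solution on `[0, T)` — joint smoothness and the one-sided time
derivative are local and every point of `[0, T) × ℝ³` lies in the relative interior of some slab,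
where the glued field IS a link of the chain — and read off datum, force, energy, clock, floors and
ceilings. [folklore] -/
def Realisation.ofEpisodes {ν : ℝ} {R : TowerRates} {m : Margins R} (S : Schedule R)
    (s₁ : Stage ν R S m 1)
    (step : ∀ n, ∀ s : Stage ν R S m (n + 1), ∃ s' : Stage ν R S m (n + 1 + 1), s.Extends s') :
    Realisation ν R := by
  classical
  -- the chain and the index of the first slab containing `t`
  let st : (n : ℕ) → Stage ν R S m (n + 1) := chain s₁ step
  let idx : ℝ → ℕ := fun t => if h : ∃ n, t ≤ S.τ (n + 1) then Nat.find h else 0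
  let U : ℝ → EuclideanSpace ℝ (Fin 3) → EuclideanSpace ℝ (Fin 3) := fun t => (st (idx t)).u t
  let P : ℝ → EuclideanSpace ℝ (Fin 3) → ℝ := fun t => (st (idx t)).p t
  -- on the slab `[0, τ (n+1)]` the glued fields are the `n`-th link
  have hUP : ∀ n, ∀ t ∈ Icc 0 (S.τ (n + 1)), U t = (st n).u t ∧ P t = (st n).p t := by
    intro n t ht
    have hex : ∃ i, t ≤ S.τ (i + 1) := ⟨n, ht.2⟩
    have hidx : idx t = Nat.find hex := by
      simp only [idx]
      rw [dif_pos hex]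
    have hle : Nat.find hex ≤ n := Nat.find_min' hex ht.2
    have hti : t ∈ Icc 0 (S.τ (Nat.find hex + 1)) := ⟨ht.1, Nat.find_spec hex⟩
    obtain ⟨hu, hp⟩ := chain_agree s₁ step hle t hti
    refine ⟨?_, ?_⟩
    · show (st (idx t)).u t = (st n).u t
      rw [hidx]; exact hu.symm
    · show (st (idx t)).p t = (st n).p t
      rw [hidx]; exact hp.symm
  have hU : ∀ n, ∀ t ∈ Icc 0 (S.τ (n + 1)), U t = (st n).u t := fun n t ht => (hUP n t ht).1
  have hP : ∀ n, ∀ t ∈ Icc 0 (S.τ (n + 1)), P t = (st n).p t := fun n t ht => (hUP n t ht).2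
  -- every `t < T` lies strictly inside some slab
  have hslab : ∀ t, t < S.T → ∃ n, t < S.τ (n + 1) := fun t ht => S.exists_lt_τ ht
  -- relative openness: the slab is a neighbourhood within the half-open strip
  have hnhds : ∀ {n : ℕ} {z : ℝ × EuclideanSpace ℝ (Fin 3)}, z.1 < S.τ (n + 1) →
      z ∈ Ico (0 : ℝ) S.T ×ˢ (univ : Set (EuclideanSpace ℝ (Fin 3))) →
      Icc (0 : ℝ) (S.τ (n + 1)) ×ˢ (univ : Set (EuclideanSpace ℝ (Fin 3))) ∈
        𝓝[Ico (0 : ℝ) S.T ×ˢ univ] z := by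
    intro n z hz hzm
    refine mem_nhdsWithin.2 ⟨{w | w.1 < S.τ (n + 1)}, isOpen_lt continuous_fst continuous_const,
      hz, ?_⟩
    rintro w ⟨hw1, hw2⟩
    exact mk_mem_prod ⟨hw2.1.1, le_of_lt hw1⟩ (mem_univ _)
  -- local agreement of the glued fields with a link, as eventual equalities
  have hUev : ∀ {n : ℕ} {z : ℝ × EuclideanSpace ℝ (Fin 3)}, z.1 < S.τ (n + 1) →
      z ∈ Ico (0 : ℝ) S.T ×ˢ (univ : Set (EuclideanSpace ℝ (Fin 3))) →
      uncurry U =ᶠ[𝓝[Ico (0 : ℝ) S.T ×ˢ univ] z] uncurry (st n).u := by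
    intro n z hz hzm
    filter_upwards [hnhds hz hzm] with w hw
    simp only [uncurry]
    rw [hU n w.1 hw.1]
  have hPev : ∀ {n : ℕ} {z : ℝ × EuclideanSpace ℝ (Fin 3)}, z.1 < S.τ (n + 1) →
      z ∈ Ico (0 : ℝ) S.T ×ˢ (univ : Set (EuclideanSpace ℝ (Fin 3))) →
      uncurry P =ᶠ[𝓝[Ico (0 : ℝ) S.T ×ˢ univ] z] uncurry (st n).p := by
    intro n z hz hzm
    filter_upwards [hnhds hz hzm] with w hw
    simp only [uncurry]
    rw [hP n w.1 hw.1]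
  -- joint smoothness of the glued fields on the half-open strip
  have hUsmooth : IsSmoothSpaceTimeOn (Ico 0 S.T) U := by
    intro z hz
    obtain ⟨n, hn⟩ := hslab z.1 hz.1.2
    have hzn : z ∈ Icc (0 : ℝ) (S.τ (n + 1)) ×ˢ (univ : Set (EuclideanSpace ℝ (Fin 3))) :=
      mk_mem_prod ⟨hz.1.1, hn.le⟩ (mem_univ _)
    have h1 : ContDiffWithinAt ℝ ∞ (uncurry (st n).u) (Ico (0 : ℝ) S.T ×ˢ univ) z :=
      ((st n).classical.smooth_velocity z hzn).mono_of_mem_nhdsWithin (hnhds hn hz)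
    refine h1.congr_of_eventuallyEq (hUev hn hz) ?_
    simp only [uncurry]
    rw [hU n z.1 ⟨hz.1.1, hn.le⟩]
  have hPsmooth : IsSmoothSpaceTimeOn (Ico 0 S.T) P := by
    intro z hz
    obtain ⟨n, hn⟩ := hslab z.1 hz.1.2
    have hzn : z ∈ Icc (0 : ℝ) (S.τ (n + 1)) ×ˢ (univ : Set (EuclideanSpace ℝ (Fin 3))) :=
      mk_mem_prod ⟨hz.1.1, hn.le⟩ (mem_univ _)
    have h1 : ContDiffWithinAt ℝ ∞ (uncurry (st n).p) (Ico (0 : ℝ) S.T ×ˢ univ) z :=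
      ((st n).classical.smooth_pressure z hzn).mono_of_mem_nhdsWithin (hnhds hn hz)
    refine h1.congr_of_eventuallyEq (hPev hn hz) ?_
    simp only [uncurry]
    rw [hP n z.1 ⟨hz.1.1, hn.le⟩]
  -- the one-sided time derivative of the glued velocity is that of the link
  have hderiv : ∀ {n : ℕ} {t : ℝ}, t ∈ Ico (0 : ℝ) S.T → t < S.τ (n + 1) → ∀ x,
      timeDerivWithin (Ico 0 S.T) U t x = timeDerivWithin (Icc 0 (S.τ (n + 1))) (st n).u t x := by
    intro n t ht hn x
    have hτT : S.τ (n + 1) < S.T := S.τ_lt_T _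
    have hset : Ico (0 : ℝ) S.T ∩ Iio (S.τ (n + 1)) = Ico 0 (S.τ (n + 1)) := by
      ext s
      constructor
      · rintro ⟨⟨h0, _⟩, h2⟩; exact ⟨h0, h2⟩
      · rintro ⟨h0, h1⟩; exact ⟨⟨h0, lt_trans h1 hτT⟩, h1⟩
    have hτpos : 0 < S.τ (n + 1) := S.τ_pos _
    calc timeDerivWithin (Ico 0 S.T) U t x
        = derivWithin (fun s => U s x) (Ico 0 S.T ∩ Iio (S.τ (n + 1))) t := by
          rw [timeDerivWithin_apply, derivWithin_inter (Iio_mem_nhds hn)]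
      _ = derivWithin (fun s => U s x) (Ico 0 (S.τ (n + 1))) t := by rw [hset]
      _ = derivWithin (fun s => (st n).u s x) (Ico 0 (S.τ (n + 1))) t := by
          apply derivWithin_congr
          · intro s hs
            show U s x = (st n).u s x
            rw [hU n s ⟨hs.1, hs.2.le⟩]
          · show U t x = (st n).u t x
            rw [hU n t ⟨ht.1, hn.le⟩]
      _ = timeDerivWithin (Ico 0 (S.τ (n + 1))) (st n).u t x := by rw [timeDerivWithin_apply]
      _ = timeDerivWithin (Icc 0 (S.τ (n + 1))) (st n).u t x :=
          (st n).classical.smooth_velocity.timeDerivWithin_eq_of_subset Ico_subset_Icc_self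
            (uniqueDiffOn_Ico 0 (S.τ (n + 1))) ⟨ht.1, hn⟩ x
  -- the glued classical solution on `[0, T)`
  have hclassical : IsClassicalNSSolutionOn (Ico 0 S.T) ν S.f U P := by
    refine ⟨hUsmooth, hPsmooth, ?_, ?_⟩
    · intro t ht x
      obtain ⟨n, hn⟩ := hslab t ht.2
      have hmom := (st n).classical.momentum t ⟨ht.1, hn.le⟩ x
      have hUt : U t = (st n).u t := hU n t ⟨ht.1, hn.le⟩
      have hPt : P t = (st n).p t := hP n t ⟨ht.1, hn.le⟩
      rw [hderiv ht hn x, hUt, hPt]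
      exact hmom
    · intro t ht
      obtain ⟨n, hn⟩ := hslab t ht.2
      rw [hU n t ⟨ht.1, hn.le⟩]
      exact (st n).classical.divFree t ⟨ht.1, hn.le⟩
  have hU0 : U 0 = S.u₀ := by
    rw [hU 0 0 ⟨le_rfl, (S.τ_pos 1).le⟩]
    exact (st 0).initial
  exact
  { T := S.T
    T_pos := S.T_pos
    u := U
    p := P
    f := S.f
    classical := hclassical
    datum_decay := by rw [hU0]; exact S.datum_decay
    force_smooth := S.force_smooth
    force_decay := S.force_decay
    force_silent := S.force_silent
    energy := by
      intro T' hT'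
      obtain ⟨n, hn⟩ := hslab T' hT'
      obtain ⟨C, hC, hb⟩ := (st n).energy
      refine ⟨C, hC, fun t ht => ?_⟩
      rw [hU n t ⟨ht.1, le_trans ht.2 hn.le⟩]
      exact hb t ⟨ht.1, le_trans ht.2 hn.le⟩
    radius := S.radius
    τ := S.τ
    τ_mem := fun k => ⟨(S.τ_pos k).le, S.τ_lt_T k⟩
    c₁ := S.c₁
    c₂ := S.c₂
    c₃ := S.c₃
    c₁_pos := S.c₁_pos
    clock := S.clock
    floor := by
      intro k
      obtain ⟨x, hx, hfl⟩ := (st k).floor k (Nat.le_succ k)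
      refine ⟨x, hx, ?_⟩
      rw [hU k (S.τ k) ⟨(S.τ_pos k).le, S.τ_mono (Nat.le_succ k)⟩]
      exact hfl
    ceiling := by
      intro k t ht x
      rw [hU k t ⟨ht.1, le_trans ht.2 (S.τ_mono (Nat.le_succ k))⟩]
      exact (st k).ceiling k (Nat.le_succ k) t ht x }

/-- **K1 ∧ K2 ⇒ the interface is inhabited** (at the same viscosity), for ANY registered margin
set: the assembly of the episode split, by `Realisation.ofEpisodes`. With
`palasekStep2_of_realisation` (file `PalasekTowerViscosity`) this gives `PalasekStep2 R`, and with the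
bridge `navierStokesBreakdownR3_of_step2` Fefferman's (C), modulo W21′. [cite: Palasek2026ElementaryModel, §4] -/
theorem nonempty_realisation_of_episodes {ν : ℝ} {R : TowerRates} {m : Margins R}
    (h₁ : EpisodeBase ν R m) (h₂ : EpisodeInduction ν R m) : Nonempty (Realisation ν R) := by
  obtain ⟨S, ⟨s₁⟩⟩ := h₁
  exact ⟨Realisation.ofEpisodes S s₁ (fun n s => h₂ S (n + 1) (by omega) s)⟩

/-- **The E-C endpoint from the episode split, all viscosities** (no viscosity covariance needed in
this form): K1 and K2 at every `ν > 0` give `PalasekStep2 R`. [cite: Palasek2026ElementaryModel, §4] -/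
theorem palasekStep2_of_episodes {R : TowerRates} {m : Margins R}
    (h : ∀ ν : ℝ, 0 < ν → EpisodeBase ν R m ∧ EpisodeInduction ν R m) : PalasekStep2 R :=
  fun ν hν => nonempty_realisation_of_episodes (h ν hν).1 (h ν hν).2

end Summit.NavierStokesRegularity.FluidComputer.PalasekTowerClayBridge

end
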